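import Summits.RiemannHypothesis.RiemannHypothesis.Theorems.PfPersistenceSecondLevel
import Summits.RiemannHypothesis.RiemannHypothesis.Theorems.PfPersistenceGalerkinNesting
import HarnessLib

/-!
# PF persistence — the SECOND LEVEL `ε₂` (II): Weyl–Lipschitz (gap readers meet wall W2), gap persistence,
# and nesting in the truncation rank
(pub-rhpf, cand-3 gen 9 — CAND seat 3, variational / second-eigenvalue structure; continues
`PfPersistenceSecondLevel`: `orthRayleighSet`, Courant–Fischer attainment, `HasBottomGap ↔` gauge bound)

**HONEST FRAMING. This is a mechanism/rigidity campaign; no RH claims.** Everything in this file is RH-free,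
finite-dimensional variational algebra plus the cell's UNCONDITIONAL tally wall; the only `ζ`-specific inputs are
tree theorems about the MODEL datum `zetaDatum` (symmetry, GAL-0 `ε_ev ≤ ε₁`, part-A nesting). Labels: every
statement is PROVED; no DATA enters; nothing here bears on the truth of RH.

* §1 **WEYL–LIPSCHITZ FOR `ε₂`** (`abs_secondRayleigh_sub_le`): form-closeness `|vᵀ(M − M')v| ≤ δ|v|²` gives
  `|ε₂(M) − ε₂(M')| ≤ δ` (no symmetry; the `⨆ sInf` shape makes it immediate), hence the gauge is `2δ`-Lipschitz in
  `τ_unif`, the readers `d ↦ (ε₂(d; W i))_i` and `d ↦ (gauge(d; W i))_i` at finitely many windows of dimension `≥ 2`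
  are `ReaderContinuousAt` EVERY datum, and — by the cell's unconditional tally wall
  (`tally_not_separates_of_uniformlyRobust`) — SPECTRAL-GAP MARGIN / THRESHOLD READERS CANNOT SEPARATE `ζ` from the
  detectably negative data of any domain `⊇ arithDialSpace` (`not_separates_of_gapMarginClass_subset`,
  `not_separates_of_gapThreshold_subset`): a wholesale W2 instance for the `eps2 − eps1` column.
* §2 **GAP PERSISTENCE** (`hasBottomGap_of_formClose`): a gap `γ` at a symmetric `M₀` and a symmetric `M` that is
  `δ`-form-close with `2δ < γ` give the gap `γ − 2δ` at EVERY bottom vector of `M`; on data: the gapped class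
  `{d | ∃ u, HasBottomGap (d win) u γ'}` is robust at `ζ` WITHIN the dial space for every `0 < γ' < γ`
  (`robustWithin_dialSpace_gapped`) — the binder is an OPEN condition, so a gap at `ζ` with margin is a gap at all
  `τ_unif`-nearby dial data, and that class too cannot separate (`not_separates_of_gapped_subset`).
* §3 **NESTING IN THE TRUNCATION RANK** (Cauchy interlacing, upper half; every weight table):
  `ε₂^{(N+1)}(a) ≤ ε₂^{(N)}(a)` (`secondRayleigh_succ_le`, zero-padding as in `PfPersistenceGalerkinNesting`), so
  `N ↦ ε₂^{(N+1)}(a)` is antitone; at `ζ` it is bounded below by `ε_ev(a)` (GAL-0), hence CONVERGES to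
  `⨅_N ε₂^{(N+1)}(a) ≥ ε_ev(a)`, and the served gauge `eps2_even − eps1_even` at fixed `a` has the `N → ∞` limit
  `⨅_N ε₂^{(N+1)}(a) − ε_ev(a) ≥ 0` (`tendsto_bottomGapGauge_atTop`) — a DERIVED schema fact, no DATA.
HONEST RESIDUE (recorded, not targeted): nothing here says the gauge of `ζ`'s window matrix is positive at any
window (per-window DATA), nor identifies `⨅_N ε₂^{(N+1)}(a)` with a continuum quantity (no second-level Galerkin
density is in the tree), nor anything about the `a → ∞` behaviour of the limiting gauge (gap class G1);
dimension-one windows (`N = 0`) are excluded throughout.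
-/


set_option linter.dupNamespace false  -- the mandated namespace repeats `RiemannHypothesis`

noncomputable section

open Matrix Set Filter Topology

open Literature.NumberTheory.LFunctions

namespace Summit.RiemannHypothesis.RiemannHypothesis.Theorems.PfPersistence

/-! ## §1 Weyl–Lipschitz for `ε₂`; gap readers are reader-continuous and meet wall W2 -/

/-- PROVED: one-sided form of the Lipschitz law for the constrained infima. [folklore] -/
theorem sInf_orthRayleighSet_sub_le {n : ℕ} (hn : 0 < n) {M M' : Matrix (Fin (n + 1)) (Fin (n + 1)) ℝ} {δ : ℝ}
    (h : ∀ v : Fin (n + 1) → ℝ, |v ⬝ᵥ ((M - M') *ᵥ v)| ≤ δ * (v ⬝ᵥ v)) (u : Fin (n + 1) → ℝ) :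
    sInf (orthRayleighSet M' u) - δ ≤ sInf (orthRayleighSet M u) := by
  refine le_csInf (orthRayleighSet_nonempty hn M u) ?_
  rintro r ⟨v, hv, hvu, rfl⟩
  have hvv := dotSelf_pos_of_ne_zero hv
  have h1 : sInf (orthRayleighSet M' u) ≤ v ⬝ᵥ (M' *ᵥ v) / (v ⬝ᵥ v) :=
    csInf_le (orthRayleighSet_bddBelow M' u) ⟨v, hv, hvu, rfl⟩
  have h2 := h v
  rw [Matrix.sub_mulVec, dotProduct_sub] at h2
  have h3 := (abs_le.1 h2).1
  rw [le_div_iff₀ hvv, sub_mul]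
  rw [le_div_iff₀ hvv] at h1
  linarith

/-- **PROVED — THE `τ_unif`-LIPSCHITZ LAW OF `ε₂` (Weyl for the second level).** If two window matrices of
dimension `≥ 2` are form-close, `|vᵀ(M − M')v| ≤ δ · vᵀv` for all `v`, then `|ε₂(M) − ε₂(M')| ≤ δ`. (No symmetry,
no eigen-decomposition.) [folklore] -/
theorem abs_secondRayleigh_sub_le {n : ℕ} (hn : 0 < n) {M M' : Matrix (Fin (n + 1)) (Fin (n + 1)) ℝ} {δ : ℝ}
    (h : ∀ v : Fin (n + 1) → ℝ, |v ⬝ᵥ ((M - M') *ᵥ v)| ≤ δ * (v ⬝ᵥ v)) :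
    |secondRayleigh M - secondRayleigh M'| ≤ δ := by
  have key : ∀ A B : Matrix (Fin (n + 1)) (Fin (n + 1)) ℝ,
      (∀ v : Fin (n + 1) → ℝ, |v ⬝ᵥ ((A - B) *ᵥ v)| ≤ δ * (v ⬝ᵥ v)) →
        secondRayleigh B - δ ≤ secondRayleigh A := by
    intro A B hAB
    rw [secondRayleigh_eq_iSup B, sub_le_iff_le_add]
    refine ciSup_le fun u => ?_
    have h1 := sInf_orthRayleighSet_sub_le hn hAB u
    have h2 : sInf (orthRayleighSet A u) ≤ secondRayleigh A := sInf_orthRayleighSet_le_secondRayleigh hn A u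
    linarith
  have hMM' := key M M' h
  have hM'M : secondRayleigh M - δ ≤ secondRayleigh M' := key M' M fun v => by
    rw [← neg_sub M M', Matrix.neg_mulVec, dotProduct_neg, abs_neg]; exact h v
  rw [abs_le]; constructor <;> linarith

/-- **PROVED — `ε₂` is `1`-LIPSCHITZ IN `τ_unif` on data** at every window of dimension `≥ 2`. [folklore] -/
theorem abs_secondRayleigh_sub_le_of_uniformlyClose {ε : ℝ} {d d' : Datum} (h : UniformlyClose ε d d')
    (win : Window) (hN : 0 < win.N) : |secondRayleigh (d win) - secondRayleigh (d' win)| ≤ ε :=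
  abs_secondRayleigh_sub_le hN (h win)

/-- **PROVED — the GAUGE `ε₂ − ε₁` is `2`-LIPSCHITZ IN `τ_unif` on data** at every window of dimension `≥ 2`.
[folklore] -/
theorem abs_bottomGapGauge_sub_le_of_uniformlyClose {ε : ℝ} {d d' : Datum} (h : UniformlyClose ε d d')
    (win : Window) (hN : 0 < win.N) : |bottomGapGauge d win - bottomGapGauge d' win| ≤ 2 * ε := by
  have h1 := abs_secondRayleigh_sub_le_of_uniformlyClose h win hN
  have h2 := abs_bottomRayleigh_sub_le_of_uniformlyClose h win
  simp only [bottomGapGauge]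
  rw [abs_le] at h1 h2 ⊢
  constructor <;> linarith [h1.1, h1.2, h2.1, h2.2]

/-- **PROVED — the `R1`-continuity hypothesis DISCHARGED for SECOND-LEVEL readers:** the reader
`d ↦ (ε₂(d; W i))_i` at finitely many windows of dimension `≥ 2` is `ReaderContinuousAt` every datum. [folklore] -/
theorem readerContinuousAt_secondRayleigh {k : ℕ} (W : Fin k → Window) (hW : ∀ i, 0 < (W i).N) (d₀ : Datum) :
    ReaderContinuousAt (fun d i => secondRayleigh (d (W i))) d₀ := by
  intro η hη
  refine ⟨η / 2, half_pos hη, fun d hd i => ?_⟩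
  have := abs_secondRayleigh_sub_le_of_uniformlyClose hd (W i) (hW i)
  rw [abs_sub_comm] at this
  exact lt_of_le_of_lt this (half_lt_self hη)

/-- **PROVED — … and for GAP (gauge) readers:** `d ↦ (ε₂ − ε₁)(d; W i)_i` at finitely many windows of dimension
`≥ 2` is `ReaderContinuousAt` every datum. [folklore] -/
theorem readerContinuousAt_bottomGapGauge {k : ℕ} (W : Fin k → Window) (hW : ∀ i, 0 < (W i).N) (d₀ : Datum) :
    ReaderContinuousAt (fun d i => bottomGapGauge d (W i)) d₀ := by
  intro η hη
  refine ⟨η / 4, by positivity, fun d hd i => ?_⟩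
  have := abs_bottomGapGauge_sub_le_of_uniformlyClose hd (W i) (hW i)
  rw [abs_sub_comm] at this
  linarith

/-- **PROVED — WALL W2 FOR SECOND-LEVEL MARGIN READERS, UNCONDITIONAL:** a class containing a margin class of the
`ε₂`-reader at finitely many windows (dimension `≥ 2`) separates `ζ` from the detectably negative data of no domain
`⊇ arithDialSpace` (the cell's unconditional tally wall `tally_not_separates_of_uniformlyRobust`). [folklore] -/
theorem not_separates_of_secondMarginClass_subset {k : ℕ} (W : Fin k → Window) (hW : ∀ i, 0 < (W i).N) {η : ℝ}
    (hη : 0 < η) {S D : Set Datum} (hS : marginClass (fun d i => secondRayleigh (d (W i))) η ⊆ S)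
    (hD : arithDialSpace ⊆ D) : ¬ Separates S D zetaDatum :=
  tally_not_separates_of_uniformlyRobust hD
    (uniformlyRobustAt_of_marginClass_subset (readerContinuousAt_secondRayleigh W hW zetaDatum) hη hS)

/-- **PROVED — WALL W2 FOR SPECTRAL-GAP MARGIN READERS, UNCONDITIONAL:** a class containing a margin class of the
gauge reader `(ε₂ − ε₁)(·; W i)` at finitely many windows (dimension `≥ 2`) cannot separate `ζ` from the detectably
negative data of any domain `⊇ arithDialSpace`. [folklore] -/
theorem not_separates_of_gapMarginClass_subset {k : ℕ} (W : Fin k → Window) (hW : ∀ i, 0 < (W i).N) {η : ℝ}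
    (hη : 0 < η) {S D : Set Datum} (hS : marginClass (fun d i => bottomGapGauge d (W i)) η ⊆ S)
    (hD : arithDialSpace ⊆ D) : ¬ Separates S D zetaDatum :=
  tally_not_separates_of_uniformlyRobust hD
    (uniformlyRobustAt_of_marginClass_subset (readerContinuousAt_bottomGapGauge W hW zetaDatum) hη hS)

/-- **PROVED — GAP-THRESHOLD CLASSES ARE ROBUST AT `ζ`:** if `ζ`'s gauge is STRICTLY above the thresholds `θ i` at
finitely many windows (dimension `≥ 2`), the class "gauge `> θ i` at every `W i`" is `τ_unif`-robust at `ζ`.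
[folklore] -/
theorem uniformlyRobustAt_gapThreshold {k : ℕ} (W : Fin k → Window) (hW : ∀ i, 0 < (W i).N) {θ : Fin k → ℝ}
    (hθ : ∀ i, θ i < bottomGapGauge zetaDatum (W i)) :
    UniformlyRobustAt {d | ∀ i, θ i < bottomGapGauge d (W i)} zetaDatum := by
  obtain ⟨ε, hε, hle⟩ := exists_eps_forall_le (γ := fun i => bottomGapGauge zetaDatum (W i) - θ i)
    (fun i => sub_pos.2 (hθ i)) one_half_pos
  refine ⟨ε, hε, fun d hd i => ?_⟩
  have h1 := abs_bottomGapGauge_sub_le_of_uniformlyClose hd (W i) (hW i)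
  have hm : 0 < bottomGapGauge zetaDatum (W i) - θ i := sub_pos.2 (hθ i)
  have h2 := hle i
  rw [div_le_iff₀ hm] at h2
  rw [abs_le] at h1
  linarith [h1.1, h1.2]

/-- **PROVED — WALL W2 FOR GAP-THRESHOLD READERS, UNCONDITIONAL:** a class containing the data whose gauge exceeds
`θ i` at every `W i` (dimension `≥ 2`), with `ζ` strictly above the thresholds, cannot separate `ζ` from the
detectably negative data of any domain `⊇ arithDialSpace`. [folklore] -/
theorem not_separates_of_gapThreshold_subset {k : ℕ} (W : Fin k → Window) (hW : ∀ i, 0 < (W i).N)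
    {θ : Fin k → ℝ} (hθ : ∀ i, θ i < bottomGapGauge zetaDatum (W i)) {S D : Set Datum}
    (hS : {d | ∀ i, θ i < bottomGapGauge d (W i)} ⊆ S) (hD : arithDialSpace ⊆ D) : ¬ Separates S D zetaDatum := by
  obtain ⟨ε, hε, h⟩ := uniformlyRobustAt_gapThreshold W hW hθ
  exact tally_not_separates_of_uniformlyRobust hD ⟨ε, hε, fun d hd => hS (h d hd)⟩

/-! ## §2 Gap persistence: the binder is an OPEN condition in `τ_unif` (symmetric data) -/

/-- **PROVED — GAP PERSISTENCE.** If a symmetric `M₀` has the gap `γ` and a symmetric `M` is `δ`-form-close to it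
with `2δ < γ`, then EVERY bottom vector of `M` has the gap `γ − 2δ` (dimension `≥ 2`; Weyl for `ε₁` and `ε₂` plus
`hasBottomGap_iff` of `PfPersistenceSecondLevel`). [folklore] -/
theorem hasBottomGap_of_formClose {n : ℕ} (hn : 0 < n) {M₀ M : Matrix (Fin (n + 1)) (Fin (n + 1)) ℝ}
    (hM₀ : M₀.IsSymm) (hM : M.IsSymm) {u₀ : Fin (n + 1) → ℝ} {γ δ : ℝ} (hgap : HasBottomGap M₀ u₀ γ)
    (h : ∀ v : Fin (n + 1) → ℝ, |v ⬝ᵥ ((M₀ - M) *ᵥ v)| ≤ δ * (v ⬝ᵥ v)) (hδ : 2 * δ < γ)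
    {u : Fin (n + 1) → ℝ} (hu : IsBottomVector M u) : HasBottomGap M u (γ - 2 * δ) := by
  obtain ⟨-, -, hle⟩ := (hasBottomGap_iff hn hM₀).1 hgap
  have h1 := abs_secondRayleigh_sub_le hn h
  have h2 := abs_bottomRayleigh_sub_le h
  rw [abs_le] at h1 h2
  exact (hasBottomGap_iff hn hM).2 ⟨hu, by linarith, by linarith [h1.1, h1.2, h2.1, h2.2]⟩

/-- **PROVED — GAP PERSISTENCE ON THE DIAL SPACE:** a gap `γ` at `ζ`'s window (dimension `≥ 2`) and a dial-space
datum `ε`-close to `ζ` in `τ_unif` with `2ε < γ` give the gap `γ − 2ε` at every bottom vector of the datum's window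
matrix. [folklore] -/
theorem hasBottomGap_of_uniformlyClose {d : Datum} (hd : d ∈ dialSpace) {ε : ℝ} (hc : UniformlyClose ε zetaDatum d)
    (win : Window) (hN : 0 < win.N) {u₀ : Fin (win.N + 1) → ℝ} {γ : ℝ}
    (hgap : HasBottomGap (zetaDatum win) u₀ γ) (hε : 2 * ε < γ) {u : Fin (win.N + 1) → ℝ}
    (hu : IsBottomVector (d win) u) : HasBottomGap (d win) u (γ - 2 * ε) :=
  hasBottomGap_of_formClose hN (zetaDatum_isSymm win) (isSymm_of_mem_dialSpace hd win) hgap (hc win) hε hu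

/-- **PROVED — THE GAPPED CLASS IS ROBUST AT `ζ` WITHIN THE DIAL SPACE:** under a gap binder `γ` at `ζ`'s window
(dimension `≥ 2`), for every `0 < γ' < γ` the class `{d | ∃ u, HasBottomGap (d win) u γ'}` contains every
dial-space datum `τ_unif`-close enough to `ζ` (`ε := (γ − γ')/2`). [folklore] -/
theorem robustWithin_dialSpace_gapped (win : Window) (hN : 0 < win.N) {u₀ : Fin (win.N + 1) → ℝ} {γ : ℝ}
    (hgap : HasBottomGap (zetaDatum win) u₀ γ) {γ' : ℝ} (hγ' : 0 < γ') (hlt : γ' < γ) :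
    RobustWithin dialSpace {d | ∃ u, HasBottomGap (d win) u γ'} zetaDatum := by
  refine ⟨(γ - γ') / 2, by linarith, fun d hd hc => ?_⟩
  obtain ⟨u, hu, -⟩ := exists_isBottomVector_of_mem_dialSpace hd win
  have h := hasBottomGap_of_uniformlyClose hd hc win hN hgap (by linarith) hu
  have e : γ - 2 * ((γ - γ') / 2) = γ' := by ring
  rw [e] at h
  exact ⟨u, h⟩

/-- **PROVED — WALL for the gapped class (and anything containing its arithmetic part), modulo the gap binder at
`ζ`, otherwise UNCONDITIONAL.** [folklore] -/
theorem not_separates_of_gapped_subset (win : Window) (hN : 0 < win.N) {u₀ : Fin (win.N + 1) → ℝ} {γ : ℝ}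
    (hgap : HasBottomGap (zetaDatum win) u₀ γ) {γ' : ℝ} (hγ' : 0 < γ') (hlt : γ' < γ) {S D : Set Datum}
    (hS : {d | ∃ u, HasBottomGap (d win) u γ'} ∩ arithDialSpace ⊆ S) (hD : arithDialSpace ⊆ D) :
    ¬ Separates S D zetaDatum :=
  not_separates_of_robustWithin_arith hD
    (((robustWithin_dialSpace_gapped win hN hgap hγ' hlt).anti arithDialSpace_subset_dialSpace).mono hS)

/-! ## §3 Nesting of `ε₂` in the truncation rank; the `N → ∞` limit of the gauge at `ζ` -/

/-- PROVED: the dot product of a zero-padded vector with an arbitrary vector sees only the leading coordinates.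
[folklore] -/
theorem snoc_zero_dotProduct_left {N : ℕ} (v : Fin (N + 1) → ℝ) (u : Fin (N + 1 + 1) → ℝ) :
    (Fin.snoc v 0 : Fin (N + 1 + 1) → ℝ) ⬝ᵥ u = v ⬝ᵥ fun i => u i.castSucc := by
  simp [dotProduct, Fin.sum_univ_castSucc, Fin.snoc_castSucc, Fin.snoc_last]

/-- PROVED (every weight table): zero-padding maps the orthogonal Rayleigh set of the rank-`N` block at the
truncated vector into the orthogonal Rayleigh set of the rank-`N+1` block. [folklore] -/
theorem orthRayleighSet_subset_succ (w : Weights) (a : ℝ) (ha : 0 < a) (N : ℕ) (u : Fin (N + 1 + 1) → ℝ) :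
    orthRayleighSet (datumOf w ⟨a, N, ha⟩) (fun i => u i.castSucc) ⊆
      orthRayleighSet (datumOf w ⟨a, N + 1, ha⟩) u := by
  rintro r ⟨v, hv, hvu, rfl⟩
  refine ⟨Fin.snoc v 0, snoc_zero_ne_zero hv, by rw [snoc_zero_dotProduct_left]; exact hvu, ?_⟩
  rw [datumOf_form_snoc_zero, snoc_zero_dotProduct]

/-- **PROVED — `ε₂^{(N+1)}(a) ≤ ε₂^{(N)}(a)`** (every weight table, `N ≥ 1`): enlarging the truncation can only
lower the second level (the upper half of Cauchy interlacing for a leading principal corner). [folklore] -/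
theorem secondRayleigh_succ_le (w : Weights) (a : ℝ) (ha : 0 < a) {N : ℕ} (hN : 0 < N) :
    secondRayleigh (datumOf w ⟨a, N + 1, ha⟩) ≤ secondRayleigh (datumOf w ⟨a, N, ha⟩) := by
  rw [secondRayleigh_eq_iSup (datumOf w ⟨a, N + 1, ha⟩)]
  refine ciSup_le fun u => ?_
  calc sInf (orthRayleighSet (datumOf w ⟨a, N + 1, ha⟩) u)
      ≤ sInf (orthRayleighSet (datumOf w ⟨a, N, ha⟩) fun i => u i.castSucc) :=
        csInf_le_csInf (orthRayleighSet_bddBelow _ _) (orthRayleighSet_nonempty hN _ _)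
          (orthRayleighSet_subset_succ w a ha N u)
    _ ≤ secondRayleigh (datumOf w ⟨a, N, ha⟩) := sInf_orthRayleighSet_le_secondRayleigh hN _ _

/-- **PROVED — the served second level is ANTITONE in the truncation rank** (every weight table; ranks `N + 1`,
`N : ℕ`, so that every window has dimension `≥ 2`). [folklore] -/
theorem secondRayleigh_antitone (w : Weights) (a : ℝ) (ha : 0 < a) :
    Antitone fun N : ℕ => secondRayleigh (datumOf w ⟨a, N + 1, ha⟩) :=
  antitone_nat_of_succ_le fun N => secondRayleigh_succ_le w a ha N.succ_pos

/-- PROVED: the same at `ζ` (`zetaDatum = datumOf zetaWeights`). [folklore] -/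
theorem zeta_secondRayleigh_antitone (a : ℝ) (ha : 0 < a) :
    Antitone fun N : ℕ => secondRayleigh (zetaDatum ⟨a, N + 1, ha⟩) :=
  secondRayleigh_antitone zetaWeights a ha

/-- PROVED: `ε_ev(a) ≤ ε₂^{(N)}(a)` at `ζ` for every rank `N ≥ 1` (GAL-0 `ε_ev ≤ ε₁^{(N)}` and `ε₁ ≤ ε₂`).
[folklore] -/
theorem weilEvenGroundEnergy_le_secondRayleigh {a : ℝ} (ha : 0 < a) {N : ℕ} (hN : 0 < N) :
    weilEvenGroundEnergy a ≤ secondRayleigh (zetaDatum ⟨a, N, ha⟩) :=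
  (weilEvenGroundEnergy_le_bottomRayleigh' ⟨a, N, ha⟩).trans (bottomRayleigh_le_secondRayleigh hN _)

/-- PROVED: the second-level ladder at `ζ` is bounded below (by `ε_ev(a)`). [folklore] -/
theorem bddBelow_range_secondRayleigh {a : ℝ} (ha : 0 < a) :
    BddBelow (Set.range fun N : ℕ => secondRayleigh (zetaDatum ⟨a, N + 1, ha⟩)) := by
  refine ⟨weilEvenGroundEnergy a, ?_⟩
  rintro r ⟨N, rfl⟩
  exact weilEvenGroundEnergy_le_secondRayleigh ha N.succ_pos

/-- **PROVED — the second-level ladder at `ζ` CONVERGES** (monotonically from above) to its infimum. [folklore] -/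
theorem tendsto_secondRayleigh_atTop {a : ℝ} (ha : 0 < a) :
    Tendsto (fun N : ℕ => secondRayleigh (zetaDatum ⟨a, N + 1, ha⟩)) atTop
      (𝓝 (⨅ N : ℕ, secondRayleigh (zetaDatum ⟨a, N + 1, ha⟩))) :=
  tendsto_atTop_ciInf (zeta_secondRayleigh_antitone a ha) (bddBelow_range_secondRayleigh ha)

/-- PROVED: `ε_ev(a) ≤ ⨅_N ε₂^{(N+1)}(a)`. [folklore] -/
theorem weilEvenGroundEnergy_le_iInf_secondRayleigh {a : ℝ} (ha : 0 < a) :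
    weilEvenGroundEnergy a ≤ ⨅ N : ℕ, secondRayleigh (zetaDatum ⟨a, N + 1, ha⟩) :=
  le_ciInf fun N => weilEvenGroundEnergy_le_secondRayleigh ha N.succ_pos

/-- **PROVED — THE SERVED GAUGE HAS AN `N → ∞` LIMIT AT EVERY FIXED `a`:** `(ε₂ − ε₁)^{(N+1)}(a) →
⨅_N ε₂^{(N+1)}(a) − ε_ev(a)` (part A: `ε₁^{(N)}(a) → ε_ev(a)`). [folklore] -/
theorem tendsto_bottomGapGauge_atTop {a : ℝ} (ha : 0 < a) :
    Tendsto (fun N : ℕ => bottomGapGauge zetaDatum ⟨a, N + 1, ha⟩) atTop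
      (𝓝 ((⨅ N : ℕ, secondRayleigh (zetaDatum ⟨a, N + 1, ha⟩)) - weilEvenGroundEnergy a)) :=
  (tendsto_secondRayleigh_atTop ha).sub
    ((tendsto_bottomRayleigh_weilEvenGroundEnergy ha).comp (tendsto_add_atTop_nat 1))

/-- PROVED: the limiting gauge is nonnegative. [folklore] -/
theorem iInf_secondRayleigh_sub_weilEvenGroundEnergy_nonneg {a : ℝ} (ha : 0 < a) :
    0 ≤ (⨅ N : ℕ, secondRayleigh (zetaDatum ⟨a, N + 1, ha⟩)) - weilEvenGroundEnergy a :=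
  sub_nonneg.2 (weilEvenGroundEnergy_le_iInf_secondRayleigh ha)

/-- PROVED: every rung bounds the limit, `⨅_N ε₂^{(N+1)}(a) ≤ ε₂^{(N+1)}(a)`. [folklore] -/
theorem iInf_secondRayleigh_le_rung {a : ℝ} (ha : 0 < a) (N : ℕ) :
    (⨅ N : ℕ, secondRayleigh (zetaDatum ⟨a, N + 1, ha⟩)) ≤ secondRayleigh (zetaDatum ⟨a, N + 1, ha⟩) :=
  ciInf_le (bddBelow_range_secondRayleigh ha) N

end Summit.RiemannHypothesis.RiemannHypothesis.Theorems.PfPersistence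

end
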